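import Summits.ValiantsHypothesis.ValiantsHypothesis.Cruxes.OrbitDimensionBound.Lines.MultipleLadder

set_option linter.dupNamespace false

/-!
# F3 / BC5 witness for the rung `AffineMultipleShadow` (ladder `Lines/MultipleLadder.lean`, forward rung g11)

The numeric family `MultipleCovering δ` (equivariant affine representations of non-zero MULTIPLES `per_n · q`,
`deg q ≤ δ`, covering bound with loss factor `δ + 1`) specialises AT THE FLOOR'S PARAMETER `δ = 0` to the proved floor
`SubtorusCovering`: a degree-`0` cofactor is a non-zero constant `c`, and `c · per_n` is rescaled to `per_n` INSIDE the
gauge group (`Multiple.exists_rescale`), so the seed theorem `subtorusCovering_proof` proves the `δ = 0` member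
(`multipleCovering_zero_iff`), and the `δ = 0` shadow follows unconditionally and IS the floor's own shadow
`Confusion.CoveringShadow powLoss` (`multipleShadow_zero_iff`).  The rung is the `δ = 1` member
(`AffineMultipleCovering` / `AffineMultipleShadow`), one notch up the SAME dial; it lies outside the Statement's known
regime because no lower bound for (equivariant or not) affine determinantal representations of proper MULTIPLES of the
permanent is in print (Landsberg–Ressayre treat `per_n` itself; von zur Gathen's regularity, the engine of the floor's
terminal theorem, fails on the reducible hypersurface `per_n · ℓ = 0`), and the Statement itself is open.
-/

namespace Summit.ValiantsHypothesis.ValiantsHypothesis.Cruxes.OrbitDimensionBound.Multiple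

open Summit.ValiantsHypothesis.ValiantsHypothesis.Theorems.FreeSubtorusSubtorusCovering

/-- The family at the floor's parameter IS the floor (up to rescaling a constant cofactor): closed by the seed theorem. -/
example : MultipleCovering 0 := multipleCovering_zero_iff.mpr subtorusCovering_proof

/-- The same, by the ladder's name. -/
example : MultipleCovering 0 := multipleCovering_zero

/-- The shadow family at the floor's parameter, unconditionally (seed ⇒ numeric `δ = 0` member ⇒ its shadow). -/
theorem multipleShadow_zero_special : MultipleShadow 0 :=
  multipleShadow_of_multipleCovering (multipleCovering_zero_iff.mpr subtorusCovering_proof)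

/-- And in the floor's own gauge: the `δ = 0` shadow is the floor's shadow `CoveringShadow powLoss`. -/
example : Confusion.CoveringShadow Confusion.powLoss := multipleShadow_zero_iff.mp multipleShadow_zero_special

/-- The dial is monotone: the rung implies the floor's shadow (and every lower notch). -/
example (h : AffineMultipleShadow) : MultipleShadow 0 := MultipleShadow.anti (Nat.zero_le 1) h

end Summit.ValiantsHypothesis.ValiantsHypothesis.Cruxes.OrbitDimensionBound.Multiple
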